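import Mathlib.Algebra.Order.BigOperators.Group.Finset
import Mathlib.Algebra.BigOperators.Ring.Finset
import Mathlib.Data.Real.Basic
import Mathlib.Tactic.Linarith
import Mathlib.Tactic.Ring
import Mathlib.Tactic.Positivity
import HarnessLib

/-!
# One-step scheme, `(2′)` for sub-block thresholds — the MEDIANT (ball ≼ band) step and the source/target comparison `S ≤ T`

Support file (prover prim-ineq-prove-3 gen 20; `--supports stmt-CriticalPhenomena-4575`; memo
`run/shared/lean/prim/prim-ineq-prove-3/FINDING-G20-COUPLING-SPLIT.md` §2 (Step 3, LEMMA S≤T) and §3).  Pure finite-sum real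
inequalities (no measure theory, no definitions, no sorries): the "grid" form of the sub-block threshold theorem works with an
array `u k j` (cell masses `μ(U ∩ {N_T = k} ∩ {N_R = j})`), row weights `a k = μ{N_T = k}`, column weights `b j = μ{N_R = j}`, and the
two monotonicity hypotheses (F1) `u k j · a k' ≤ u k' j · a k` (`k ≤ k'`), (F2) `u k j · b j' ≤ u k j' · b j` (`j ≤ j'`) supplied by
`…SubblockLayer.real_inter_inter_layer_mul_le`.

* `cross_sum_mul_le` — if `u j · b j' ≤ u j' · b j` for all `j ∈ I`, `j' ∈ I'`, then `(Σ_I u)(Σ_{I'} b) ≤ (Σ_{I'} u)(Σ_I b)`;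
* `ball_sum_mul_band_le` — BALL ≼ BAND in one row: `(Σ_{m+j<t} u_j)(Σ_{band} b_j) ≤ (Σ_{band} u_j)(Σ_{m+j<t} b_j)` for the band
  `{t ≤ k'+j, k+j < t}` when `k ≤ m` (three-block mediant argument);
* `source_mul_le_target_mul` — LEMMA S≤T of the memo: for `k ≤ m ≤ k'`,
  `(Σ_{m+j<t} u_{m j}) · a_{k'} · W_{k k'} ≤ (Σ_{band} u_{k' j}) · a_m · F_m`, `W = Σ_{band} b`, `F_m = Σ_{m+j<t} b`.
-/

namespace Summit.CriticalPhenomena.PercolationContinuityZ3.Theorems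

namespace SahiOneStep

open Finset

/-- Cross-multiplied comparison of two index blocks: if `u j · b j' ≤ u j' · b j` for all `j ∈ I`, `j' ∈ I'`, then
`(Σ_I u)(Σ_{I'} b) ≤ (Σ_{I'} u)(Σ_I b)`. [folklore] -/
theorem cross_sum_mul_le (I I' : Finset ℕ) (u b : ℕ → ℝ) (h : ∀ j ∈ I, ∀ j' ∈ I', u j * b j' ≤ u j' * b j) :
    (∑ j ∈ I, u j) * (∑ j' ∈ I', b j') ≤ (∑ j' ∈ I', u j') * (∑ j ∈ I, b j) := by
  rw [Finset.sum_mul_sum, Finset.sum_mul_sum]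
  conv_rhs => rw [Finset.sum_comm]
  exact Finset.sum_le_sum fun j hj => Finset.sum_le_sum fun j' hj' => h j hj j' hj'

/-- Splitting an `if`-sum by a further decidable condition. [folklore] -/
theorem sum_ite_split (N : ℕ) (P Q : ℕ → Prop) [DecidablePred P] [DecidablePred Q] (f : ℕ → ℝ) :
    (∑ j ∈ range N, if P j then f j else 0) =
      (∑ j ∈ range N, if P j ∧ Q j then f j else 0) + (∑ j ∈ range N, if P j ∧ ¬ Q j then f j else 0) := by
  rw [← Finset.sum_add_distrib]
  refine Finset.sum_congr rfl fun j _ => ?_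
  by_cases hP : P j <;> by_cases hQ : Q j <;> simp [hP, hQ]

/-- An `if`-sum over `range N` is the sum over the filtered range. [folklore] -/
theorem sum_ite_eq_sum_filter (N : ℕ) (P : ℕ → Prop) [DecidablePred P] (f : ℕ → ℝ) :
    (∑ j ∈ range N, if P j then f j else 0) = ∑ j ∈ (range N).filter P, f j := by
  rw [Finset.sum_filter]

/-- **BALL ≼ BAND in one row.**  For `u, b` on a row with (F2) `u j · b j' ≤ u j' · b j` (`j ≤ j'`), a threshold `t` and `k ≤ m`: `(Σ_{m+j<t} u)·(Σ_{t≤k'+j, k+j<t} b) ≤ (Σ_{t≤k'+j, k+j<t} u)·(Σ_{m+j<t} b)`.  Proof: split the ball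
`{m+j<t}` and the band into the three consecutive blocks (ball below band, overlap, band above ball) and use `cross_sum_mul_le` on the three
pairs of blocks (weighted mediant inequality). [this work] -/
theorem ball_sum_mul_band_le (N : ℕ) (u b : ℕ → ℝ)
    (F2 : ∀ j j', j ≤ j' → u j * b j' ≤ u j' * b j) {k m k' t : ℕ} (hkm : k ≤ m) :
    (∑ j ∈ range N, if m + j < t then u j else 0) * (∑ j ∈ range N, if t ≤ k' + j ∧ k + j < t then b j else 0) ≤
      (∑ j ∈ range N, if t ≤ k' + j ∧ k + j < t then u j else 0) * (∑ j ∈ range N, if m + j < t then b j else 0) := by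
  -- the three blocks
  set I₁ := (range N).filter (fun j => m + j < t ∧ ¬ t ≤ k' + j) with hI₁
  set I₂ := (range N).filter (fun j => m + j < t ∧ t ≤ k' + j) with hI₂
  set I₃ := (range N).filter (fun j => (t ≤ k' + j ∧ k + j < t) ∧ ¬ m + j < t) with hI₃
  -- ball = I₂ + I₁, band = I₂ + I₃ (for both `u` and `b`)
  have ball_split : ∀ f : ℕ → ℝ, (∑ j ∈ range N, if m + j < t then f j else 0) = (∑ j ∈ I₂, f j) + (∑ j ∈ I₁, f j) := by
    intro f
    rw [sum_ite_split N (fun j => m + j < t) (fun j => t ≤ k' + j) f, sum_ite_eq_sum_filter, sum_ite_eq_sum_filter]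
  have band_split : ∀ f : ℕ → ℝ, (∑ j ∈ range N, if t ≤ k' + j ∧ k + j < t then f j else 0) = (∑ j ∈ I₂, f j) + (∑ j ∈ I₃, f j) := by
    intro f
    rw [sum_ite_split N (fun j => t ≤ k' + j ∧ k + j < t) (fun j => m + j < t) f, sum_ite_eq_sum_filter, sum_ite_eq_sum_filter]
    congr 1
    refine Finset.sum_congr ?_ fun _ _ => rfl
    refine Finset.filter_congr fun j _ => ?_
    constructor
    · rintro ⟨⟨h1, _⟩, h3⟩; exact ⟨h3, h1⟩
    · rintro ⟨h3, h1⟩; exact ⟨⟨h1, by omega⟩, h3⟩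
  -- the three cross inequalities
  have c12 : (∑ j ∈ I₁, u j) * (∑ j ∈ I₂, b j) ≤ (∑ j ∈ I₂, u j) * (∑ j ∈ I₁, b j) := by
    refine cross_sum_mul_le I₁ I₂ u b fun j hj j' hj' => F2 j j' ?_
    rw [hI₁, Finset.mem_filter] at hj; rw [hI₂, Finset.mem_filter] at hj'; omega
  have c13 : (∑ j ∈ I₁, u j) * (∑ j ∈ I₃, b j) ≤ (∑ j ∈ I₃, u j) * (∑ j ∈ I₁, b j) := by
    refine cross_sum_mul_le I₁ I₃ u b fun j hj j' hj' => F2 j j' ?_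
    rw [hI₁, Finset.mem_filter] at hj; rw [hI₃, Finset.mem_filter] at hj'; omega
  have c23 : (∑ j ∈ I₂, u j) * (∑ j ∈ I₃, b j) ≤ (∑ j ∈ I₃, u j) * (∑ j ∈ I₂, b j) := by
    refine cross_sum_mul_le I₂ I₃ u b fun j hj j' hj' => F2 j j' ?_
    rw [hI₂, Finset.mem_filter] at hj; rw [hI₃, Finset.mem_filter] at hj'; omega
  rw [ball_split u, ball_split b, band_split u, band_split b]
  nlinarith [c12, c13, c23]

/-- **LEMMA S≤T** (memo §2, Step 3): for `k ≤ m ≤ k'`, the ball-mass of row `m` against the target weight of the pair `(k,k')` is at most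
the band-mass of row `k'` against the source weight of `m`:
`(Σ_{m+j<t} u_{m j}) · a_{k'} · (Σ_{t≤k'+j, k+j<t} b_j) ≤ (Σ_{t≤k'+j, k+j<t} u_{k' j}) · a_m · (Σ_{m+j<t} b_j)`
(ball ≼ band in row `m`, then row monotonicity (F1) from `m` to `k'` on the band). [this work] -/
theorem source_mul_le_target_mul (N : ℕ) (u : ℕ → ℕ → ℝ) (a b : ℕ → ℝ) (ha : ∀ k, 0 ≤ a k) (hb : ∀ j, 0 ≤ b j) (F1 : ∀ k k' j, k ≤ k' → u k j * a k' ≤ u k' j * a k)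
    (F2 : ∀ k j j', j ≤ j' → u k j * b j' ≤ u k j' * b j) {k m k' t : ℕ} (hkm : k ≤ m) (hmk' : m ≤ k') :
    (∑ j ∈ range N, if m + j < t then u m j else 0) * a k' * (∑ j ∈ range N, if t ≤ k' + j ∧ k + j < t then b j else 0) ≤
      (∑ j ∈ range N, if t ≤ k' + j ∧ k + j < t then u k' j else 0) * a m *
        (∑ j ∈ range N, if m + j < t then b j else 0) := by
  have step1 := ball_sum_mul_band_le N (u m) b (F2 m) (k := k) (k' := k') (t := t) hkm
  -- (F1) on the band, summed
  have step2 : (∑ j ∈ range N, if t ≤ k' + j ∧ k + j < t then u m j else 0) * a k' ≤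
      (∑ j ∈ range N, if t ≤ k' + j ∧ k + j < t then u k' j else 0) * a m := by
    rw [Finset.sum_mul, Finset.sum_mul]
    refine Finset.sum_le_sum fun j _ => ?_
    by_cases h : t ≤ k' + j ∧ k + j < t
    · rw [if_pos h, if_pos h]; exact F1 m k' j hmk'
    · rw [if_neg h, if_neg h]; simp
  have hW : 0 ≤ ∑ j ∈ range N, (if t ≤ k' + j ∧ k + j < t then b j else 0) :=
    Finset.sum_nonneg fun j _ => by split_ifs <;> simp [hb j]
  have hF : 0 ≤ ∑ j ∈ range N, (if m + j < t then b j else 0) :=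
    Finset.sum_nonneg fun j _ => by split_ifs <;> simp [hb j]
  have hak' := ha k'
  calc (∑ j ∈ range N, if m + j < t then u m j else 0) * a k' * (∑ j ∈ range N, if t ≤ k' + j ∧ k + j < t then b j else 0)
      = ((∑ j ∈ range N, if m + j < t then u m j else 0) * (∑ j ∈ range N, if t ≤ k' + j ∧ k + j < t then b j else 0)) * a k' := by
        ring
    _ ≤ ((∑ j ∈ range N, if t ≤ k' + j ∧ k + j < t then u m j else 0) * (∑ j ∈ range N, if m + j < t then b j else 0)) * a k' :=
        mul_le_mul_of_nonneg_right step1 hak'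
    _ = ((∑ j ∈ range N, if t ≤ k' + j ∧ k + j < t then u m j else 0) * a k') * (∑ j ∈ range N, if m + j < t then b j else 0) := by
        ring
    _ ≤ ((∑ j ∈ range N, if t ≤ k' + j ∧ k + j < t then u k' j else 0) * a m) * (∑ j ∈ range N, if m + j < t then b j else 0) :=
        mul_le_mul_of_nonneg_right step2 hF
    _ = _ := by ring

end SahiOneStep

end Summit.CriticalPhenomena.PercolationContinuityZ3.Theorems
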